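import Mathlib
import Literature.Combinatorics.Additive.TripleProductProperty

/-!
# Stub `stub_diffDisjoint` of line `Sketch` — crux `stmt-MatrixMultiplication-7359` (`SingleAutomatonRigidity`)

Route `MatrixMultiplication/AutomaticSTPPDesigns`, crux `stmt-MatrixMultiplication-7359`
(`Summit.MatrixMultiplication.MatrixMultiplication.Theses.AutomaticSTPPDesigns.SingleAutomatonRigidity`),
line `Sketch`, stub `stub_diffDisjoint`.

This is the "unique representation / packing injection" step: for an STPP family `(Aᵢ, Bᵢ, Cᵢ)ᵢ` in
an additive abelian group with all `Cᵢ` nonempty, the block-difference sets `Aᵢ - Bᵢ` and `Aⱼ - Bⱼ`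
are disjoint for `i ≠ j`.  Proof: if `a - b = a' - b'` with `a ∈ Aᵢ`, `b ∈ Bᵢ`, `a' ∈ Aⱼ`,
`b' ∈ Bⱼ`, pick `x ∈ Cⱼ`; then `(a - a') + (b' - b) + (x - x) = 0`, and the one-clause form of the
STPP (`Literature.Combinatorics.Additive.addSimultaneousTPP_iff_forall`) with indices `(i, j, j)`
forces `i = j`.
-/

set_option linter.dupNamespace false

namespace Summit.MatrixMultiplication.MatrixMultiplication.Theorems.SingleAutomatonRigidity

open Finset
open Literature.Combinatorics.Additive

/-- **Block-difference sets of an STPP family are pairwise disjoint.** If `(Aᵢ, Bᵢ, Cᵢ)ᵢ` has the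
(additive) simultaneous triple product property and every `Cᵢ` is nonempty, then for `i ≠ j` the
difference sets `Aᵢ - Bᵢ` and `Aⱼ - Bⱼ` are disjoint: a coincidence `a - b = a' - b'` gives the
zero-sum `(a - a') + (b' - b) + (x - x) = 0` (`x ∈ Cⱼ`), and the one-clause STPP with indices
`(i, j, j)` yields `i = j`. -/
theorem stub_diffDisjoint {H : Type*} [AddCommGroup H] [DecidableEq H] {ι : Type*}
    (A B C : ι → Finset H) (hS : AddSimultaneousTPP A B C) (hC : ∀ i, (C i).Nonempty)
    {i j : ι} (hij : i ≠ j) :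
    Disjoint (image₂ (· - ·) (A i) (B i)) (image₂ (· - ·) (A j) (B j)) := by
  rw [Finset.disjoint_left]
  intro d hdi hdj
  obtain ⟨a, ha, b, hb, rfl⟩ := Finset.mem_image₂.1 hdi
  obtain ⟨a', ha', b', hb', he⟩ := Finset.mem_image₂.1 hdj
  have he' : a' - b' = a - b := he
  obtain ⟨x, hx⟩ := hC j
  -- one-clause STPP with indices `(i, j, j)`: `s := a' ∈ A j`, `s' := a ∈ A i`, `t := b ∈ B i`,
  -- `t' := b' ∈ B j`, `u := x ∈ C j`, `u' := x ∈ C j`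
  have h0 : a - a' + (b' - b) + (x - x) = 0 := by
    rw [show a - a' + (b' - b) + (x - x) = (a - b) - (a' - b') by abel, he', sub_self]
  obtain ⟨hij', -⟩ :=
    (addSimultaneousTPP_iff_forall A B C).1 hS i j j a' ha' a ha b hb b' hb' x hx x hx h0
  exact hij hij'

end Summit.MatrixMultiplication.MatrixMultiplication.Theorems.SingleAutomatonRigidity
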